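import Mathlib
import Literature.NumberTheory.LFunctions.Zhang2022.Section5Lemma54DeltaDeriv
import HarnessLib

/-!
# Zhang (2022), §5, proof of Lemma 5.3, case `x > t₀^{1.02}`: the contour shift behind (5.12) and
# the resulting explicit form of (5.9), kernel-checked

Topic `Literature/NumberTheory/LFunctions/Zhang2022` (Landau–Siegel autopsy tree; verdict-neutral).
Y. Zhang, *Discrete mean estimates and the Landau–Siegel zero*, arXiv:2211.02515v1 (2022) — **an
unrefereed manuscript, a claimed result under adjudication** (cell pub-zhang: audit + repair census
of arXiv:2211.02515; no claim about Landau–Siegel).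

Glossary: `\l` = `𝓛 = log D`; `𝓛₂ = 𝓛^{400}` ((2.15)); `s₀ = 1/2 + 2πit₀`. Source text, §5 p. 11:

> Now assume `x > t₀^{1.02}`. By Cauchy's theorem, the proof of (5.9) is reduced to showing that
> `∫_{L′_j} exp{s₀w − 𝓛₂²w² − 2πix(e^w − 1)} dw ≪ exp{−(10^{−2}𝓛₂ log x)²} + exp{−x^{0.99}/𝓛₂}`  (5.12)
> where `L′_j`, `1 ≤ j ≤ 3`, denote the segments `L′₁ = (−∞, −10^{−2}log x]`,
> `L′₂ = [−10^{−2}log x, −10^{−2}log x − i/𝓛₂]`, `L′₃ = [−10^{−2}log x − i/𝓛₂, ∞ − i/𝓛₂)`. […]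
> If `w ∈ L′₁`, then the right side of (5.13) is `≤ ½u − (10^{−2}𝓛₂ log x)²`. This yields (5.12)
> with `j = 1`. For `w ∈ L′₂ ∪ L′₃` we have `xe^u ≥ x^{0.99} > 2t₀` and `−1/𝓛₂ ≤ v ≤ 0`, so that
> `2π(xe^u sin v/v − t₀) > x^{0.99}`. If `w ∈ L′₂`, then […] `≤ −(10^{−2}𝓛₂ log x)² + O(1)`. This
> yields (5.12) with `j = 2`. If `w ∈ L′₃`, then […] `< 1 + ½u − (𝓛₂u)² − x^{0.99}/𝓛₂`. This yields
> (5.12) with `j = 3`. □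

With `Δ` read through (5.10) (`Lemma53.Delta510`) and the pointwise inputs of
`Section5Lemma53Phase` ((5.13) and the three right-side bounds), this file PROVES, for free reals
`L₂ ≥ 1`, `t₀`, `x ≥ 0`, `a` (for `−10^{−2}log x`) and `X > 0` (for `x^{0.99}`):

* `Lemma53.Delta510_eq_contour` — "By Cauchy's theorem": for `x ≥ 0`,
  `Δ(x) = ∫_{u ≤ a} e^{phase(u)} du + ∫_{u > a} e^{phase(u − i/L₂)} du − i∫_{−1/L₂}^{0} e^{phase(a+iy)} dy`
  (Cauchy–Goursat on `[a, R] × [−1/L₂, 0]` and `R → ∞`; the side at `Re w = R` tends to `0`);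
* `Lemma53.norm_integral_L1'_le`, `norm_integral_L2'_le`, `norm_integral_L3'_le` — (5.12) for
  `j = 1, 2, 3` with explicit constants: `≤ 2e^{−(cL₂ log x)²}`, `≤ e^{1−(cL₂ log x)²}/L₂`,
  `≤ e^{1 + 1/(16L₂²)}(√π/L₂)·e^{−X/L₂}`, under `a = −c·log x`, `c·log x ≥ 0`, `X ≤ xe^{a}`, `2t₀ < X`;
* `Lemma53.norm_Delta510_le_caseTwo` — **(5.9) in explicit form**:
  `‖Δ(x)‖ ≤ 2e^{−(cL₂ log x)²} + e^{1−(cL₂ log x)²}/L₂ + e^{1+1/(16L₂²)}(√π/L₂)e^{−X/L₂}`.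

With the manuscript's `c = 10^{−2}`, `X = x^{0.99} = xe^{−c log x}` and `x > t₀^{1.02}` (so
`X > 2t₀`) this is "`Δ(x) ≪ exp{−(10^{−2}𝓛₂ log x)²} + exp{−x^{0.99}/𝓛₂}`"; that bookkeeping is not
introduced here. Nothing about Theorems 1–2 of the source is stated or implied; nothing here bears
on the cell's verdict on (8.24).

## References

* Y. Zhang, arXiv:2211.02515v1 (2022), §5 p. 11, Lemma 5.3, (5.9), (5.12), (5.13).
  [cite: Zhang2022LandauSiegel, §5 Lemma 5.3 (proof), (5.9), (5.12)]
-/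

noncomputable section

open Complex Real Set MeasureTheory Filter Topology intervalIntegral

namespace Literature.NumberTheory.LFunctions.Zhang2022

namespace Lemma53

/-! ## Integrability of the shifted integrand and the vanishing of the far side -/

/-- The real part of the phase on the line `Im w = v` with `−1 ≤ v ≤ 0`, for `x ≥ 0`:
`Re phase(u + iv) ≤ u/2 − L₂²u² + L₂²v² + 2π|t₀|` (the term `2πx e^u sin v` is `≤ 0`; from (5.13)).
[cite: Zhang2022LandauSiegel, §5 (5.13)] -/
lemma re_phase_le_of_neg_one_le {L₂ t₀ x u v : ℝ} (hx : 0 ≤ x) (hv1 : -1 ≤ v) (hv0 : v ≤ 0) :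
    (phase L₂ t₀ x (u + v * I)).re ≤ u / 2 - L₂ ^ 2 * u ^ 2 + L₂ ^ 2 * v ^ 2 + 2 * π * |t₀| := by
  rw [re_phase_eq]
  have hsinc : v * Real.sinc v = Real.sin v := by
    by_cases hv : v = 0
    · simp [hv]
    · rw [Real.sinc_of_ne_zero hv]; field_simp
  have hsin : Real.sin v ≤ 0 :=
    Real.sin_nonpos_of_nonpos_of_neg_pi_le hv0 (by linarith [Real.pi_gt_three])
  have h1 : 2 * π * v * (x * Real.exp u * Real.sinc v - t₀)
      = 2 * π * (x * Real.exp u) * (v * Real.sinc v) - 2 * π * v * t₀ := by ring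
  rw [h1, hsinc]
  have h2 : 2 * π * (x * Real.exp u) * Real.sin v ≤ 0 := by
    have : 0 ≤ 2 * π * (x * Real.exp u) := by positivity
    nlinarith
  have h3 : -(2 * π * v * t₀) ≤ 2 * π * |t₀| := by
    have hv : |v| ≤ 1 := by rw [abs_of_nonpos hv0]; linarith
    have : |v * t₀| ≤ |t₀| := by
      rw [abs_mul]; nlinarith [abs_nonneg t₀]
    have := neg_abs_le (v * t₀)
    nlinarith [Real.pi_pos, abs_nonneg (v * t₀)]
  nlinarith

/-- The integrand of (5.10) shifted to `Im w = v ∈ [−1, 0]` is integrable in `u` (`L₂ ≠ 0`, `x ≥ 0`).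
[cite: Zhang2022LandauSiegel, §5 (5.10), (5.13)] -/
lemma integrable_cexp_phase_shift {L₂ : ℝ} (hL : L₂ ≠ 0) (t₀ : ℝ) {x v : ℝ} (hx : 0 ≤ x)
    (hv1 : -1 ≤ v) (hv0 : v ≤ 0) :
    Integrable fun u : ℝ => cexp (phase L₂ t₀ x (u + v * I)) := by
  have hg := (integrable_exp_lin_sub_sq hL (1 / 2)).const_mul
    (Real.exp (L₂ ^ 2 * v ^ 2 + 2 * π * |t₀|))
  have hc : Continuous fun u : ℝ => cexp (phase L₂ t₀ x (u + v * I)) := by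
    unfold phase; fun_prop
  refine hg.mono' hc.aestronglyMeasurable (Eventually.of_forall fun u => ?_)
  rw [Complex.norm_exp, ← Real.exp_add]
  apply Real.exp_le_exp.mpr
  have := re_phase_le_of_neg_one_le (L₂ := L₂) (t₀ := t₀) (u := u) hx hv1 hv0
  linarith

/-- `R/2 − L₂²R² → −∞` (`L₂ ≥ 1`). [folklore] -/
private lemma tendsto_half_sub_sq {L₂ : ℝ} (hL : 1 ≤ L₂) :
    Tendsto (fun R : ℝ => R / 2 - L₂ ^ 2 * R ^ 2) atTop atBot := by
  rw [tendsto_atTop_atBot]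
  intro b
  refine ⟨max 1 (2 * |b|), fun R hR => ?_⟩
  have hR1 : 1 ≤ R := (le_max_left _ _).trans hR
  have hR2 : 2 * |b| ≤ R := (le_max_right _ _).trans hR
  have hL2 : 1 ≤ L₂ ^ 2 := one_le_pow₀ hL
  have : R ^ 2 ≤ L₂ ^ 2 * R ^ 2 := by nlinarith
  nlinarith [neg_abs_le b, abs_nonneg b]

/-- **The side at `Re w = R` vanishes**: `i∫_{−1/L₂}^{0} e^{phase(R + iy)} dy → 0` as `R → ∞`
(`L₂ ≥ 1`, `x ≥ 0`) — the limiting step implicit in "By Cauchy's theorem" for the unbounded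
contour `L′₃`. [cite: Zhang2022LandauSiegel, §5 Lemma 5.3 (proof), (5.12)] -/
lemma tendsto_integral_far_side {L₂ : ℝ} (hL : 1 ≤ L₂) (t₀ : ℝ) {x : ℝ} (hx : 0 ≤ x) :
    Tendsto (fun R : ℝ => I * ∫ y in (-(1 / L₂))..0, cexp (phase L₂ t₀ x (R + y * I)))
      atTop (𝓝 0) := by
  have hL0 : 0 < L₂ := by linarith
  have hL1 : 1 / L₂ ≤ 1 := (div_le_one hL0).mpr hL
  set C : ℝ := Real.exp (1 + 2 * π * |t₀|) * (1 / L₂) with hC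
  refine squeeze_zero_norm (a := fun R => C * Real.exp (R / 2 - L₂ ^ 2 * R ^ 2)) (fun R => ?_) ?_
  · -- the bound for each `R`
    have hpt : ∀ y ∈ Set.uIoc (-(1 / L₂)) (0 : ℝ),
        ‖cexp (phase L₂ t₀ x (R + y * I))‖
          ≤ Real.exp (1 + 2 * π * |t₀|) * Real.exp (R / 2 - L₂ ^ 2 * R ^ 2) := by
      intro y hy
      rw [Set.uIoc_of_le (by rw [neg_nonpos]; positivity)] at hy
      have hy1 : -1 ≤ y := by linarith [hy.1]
      have hy0 : y ≤ 0 := hy.2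
      have hyL : L₂ ^ 2 * y ^ 2 ≤ 1 := by
        have h1 : |y| ≤ 1 / L₂ := by rw [abs_of_nonpos hy0]; linarith [hy.1]
        have h2 : |y| * L₂ ≤ 1 := by
          have := mul_le_mul_of_nonneg_right h1 hL0.le
          rwa [one_div, inv_mul_cancel₀ hL0.ne'] at this
        have h0 : 0 ≤ |y| * L₂ := by positivity
        calc L₂ ^ 2 * y ^ 2 = (|y| * L₂) ^ 2 := by rw [mul_pow, sq_abs]; ring
          _ ≤ 1 := pow_le_one₀ h0 h2
      rw [Complex.norm_exp, ← Real.exp_add]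
      apply Real.exp_le_exp.mpr
      have := re_phase_le_of_neg_one_le (L₂ := L₂) (t₀ := t₀) (u := R) hx hy1 hy0
      linarith
    rw [norm_mul, Complex.norm_I, one_mul]
    calc ‖∫ y in (-(1 / L₂))..0, cexp (phase L₂ t₀ x (R + y * I))‖
        ≤ Real.exp (1 + 2 * π * |t₀|) * Real.exp (R / 2 - L₂ ^ 2 * R ^ 2) * |0 - -(1 / L₂)| :=
          intervalIntegral.norm_integral_le_of_norm_le_const hpt
      _ = C * Real.exp (R / 2 - L₂ ^ 2 * R ^ 2) := by
          rw [hC, sub_neg_eq_add, zero_add, abs_of_pos (one_div_pos.mpr hL0)]; ring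
  · -- the majorant tends to `0`
    have h := (Real.tendsto_exp_atBot.comp (tendsto_half_sub_sq hL)).const_mul C
    rw [mul_zero] at h
    exact h

/-! ## "By Cauchy's theorem": the contour `L′₁ ∪ L′₂ ∪ L′₃` -/

/-- **"By Cauchy's theorem"** (case `x > t₀^{1.02}`): for `L₂ ≥ 1`, `x ≥ 0` and any real `a`,
`Δ(x) = ∫_{u ≤ a} e^{phase(u)} du + ∫_{u > a} e^{phase(u − i/L₂)} du − i∫_{−1/L₂}^{0} e^{phase(a + iy)} dy`
— the integrals over `L′₁`, `L′₃` and (with its orientation `a → a − i/L₂`) `L′₂`.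
[cite: Zhang2022LandauSiegel, §5 Lemma 5.3 (proof), (5.12)] -/
theorem Delta510_eq_contour {L₂ : ℝ} (hL : 1 ≤ L₂) (t₀ : ℝ) {x : ℝ} (hx : 0 ≤ x) (a : ℝ) :
    Delta510 L₂ t₀ x
      = (∫ u in Iic a, cexp (phase L₂ t₀ x u))
        + (∫ u in Ioi a, cexp (phase L₂ t₀ x (u + (-(1 / L₂) : ℝ) * I)))
        - I * ∫ y in (-(1 / L₂))..0, cexp (phase L₂ t₀ x (a + y * I)) := by
  have hL0 : 0 < L₂ := by linarith
  have hL1 : 1 / L₂ ≤ 1 := (div_le_one hL0).mpr hL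
  set f : ℂ → ℂ := fun w => cexp (phase L₂ t₀ x w) with hf
  have hdiff : Differentiable ℂ f := by
    simp only [hf]; unfold phase; fun_prop
  have hint : Integrable fun u : ℝ => f u := integrable_cexp_phase hL0.ne' t₀ x
  have hint' : Integrable fun u : ℝ => f (u + (-(1 / L₂) : ℝ) * I) :=
    integrable_cexp_phase_shift hL0.ne' t₀ hx (by linarith) (by rw [neg_nonpos]; positivity)
  -- the rectangle identity for every `R`
  have hrect : ∀ R : ℝ,
      (∫ u in a..R, f u) = (∫ u in a..R, f (u + (-(1 / L₂) : ℝ) * I))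
        + I * (∫ y in (-(1 / L₂))..0, f (R + y * I))
        - I * (∫ y in (-(1 / L₂))..0, f (a + y * I)) := by
    intro R
    have h := Complex.integral_boundary_rect_eq_zero_of_differentiableOn f
      ((a : ℂ) + ((-(1 / L₂) : ℝ) : ℂ) * I) (R : ℂ) hdiff.differentiableOn
    simp only [Complex.add_re, Complex.add_im, Complex.ofReal_re, Complex.ofReal_im,
      Complex.mul_re, Complex.mul_im, Complex.I_re, Complex.I_im, mul_zero, mul_one, sub_zero,
      zero_add, add_zero, Complex.ofReal_zero, zero_mul, smul_eq_mul] at h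
    linear_combination -h
  -- limits as `R → ∞`
  have T1 : Tendsto (fun R : ℝ => ∫ u in a..R, f u) atTop (𝓝 (∫ u in Ioi a, f u)) :=
    intervalIntegral_tendsto_integral_Ioi a hint.integrableOn tendsto_id
  have T2 : Tendsto (fun R : ℝ => ∫ u in a..R, f (u + (-(1 / L₂) : ℝ) * I)) atTop
      (𝓝 (∫ u in Ioi a, f (u + (-(1 / L₂) : ℝ) * I))) :=
    intervalIntegral_tendsto_integral_Ioi a hint'.integrableOn tendsto_id
  have T3 : Tendsto (fun R : ℝ => I * ∫ y in (-(1 / L₂))..0, f (R + y * I)) atTop (𝓝 0) :=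
    tendsto_integral_far_side hL t₀ hx
  have T : Tendsto (fun R : ℝ => ∫ u in a..R, f u) atTop
      (𝓝 ((∫ u in Ioi a, f (u + (-(1 / L₂) : ℝ) * I)) + 0
        - I * (∫ y in (-(1 / L₂))..0, f (a + y * I)))) := by
    have := (T2.add T3).sub (tendsto_const_nhds
      (x := I * (∫ y in (-(1 / L₂))..0, f (a + y * I))))
    refine this.congr fun R => ?_
    rw [hrect R]
  have hlim := tendsto_nhds_unique T1 T
  rw [add_zero] at hlim
  -- assemble: `Δ = ∫_{Iic a} + ∫_{Ioi a}`
  rw [Delta510, ← intervalIntegral.integral_Iic_add_Ioi (hint.integrableOn (s := Iic a))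
    (hint.integrableOn (s := Ioi a))]
  simp only [hf] at hlim
  rw [hlim]
  ring

/-! ## (5.12) for `j = 1, 2, 3` with explicit constants -/

/-- **(5.12), `j = 1`**: for `a = −c·log x` with `c·log x ≥ 0`,
`‖∫_{u ≤ a} e^{phase(u)} du‖ ≤ 2e^{−(cL₂ log x)²}` (on `L′₁`, `Re phase ≤ u/2 − (cL₂ log x)²` and
`∫_{u ≤ a} e^{u/2} du = 2e^{a/2} ≤ 2`). [cite: Zhang2022LandauSiegel, §5 Lemma 5.3 (proof), (5.12)] -/
theorem norm_integral_L1'_le {L₂ : ℝ} (hL : L₂ ≠ 0) (t₀ x : ℝ) {c : ℝ} (hc : 0 ≤ c * Real.log x) :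
    ‖∫ u in Iic (-(c * Real.log x)), cexp (phase L₂ t₀ x u)‖
      ≤ 2 * Real.exp (-(c * L₂ * Real.log x) ^ 2) := by
  set a : ℝ := -(c * Real.log x) with ha
  set K : ℝ := (c * L₂ * Real.log x) ^ 2 with hK
  have hpt : ∀ u ∈ Iic a, ‖cexp (phase L₂ t₀ x u)‖ ≤ Real.exp (-K) * Real.exp (1 / 2 * u) := by
    intro u hu
    rw [Complex.norm_exp, ← Real.exp_add]
    apply Real.exp_le_exp.mpr
    have := re_phase_le_L1' L₂ t₀ x hc hu
    rw [← hK] at this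
    linarith
  have hint : IntegrableOn (fun u : ℝ => Real.exp (-K) * Real.exp (1 / 2 * u)) (Iic a) :=
    (integrableOn_exp_mul_Iic (by norm_num : (0 : ℝ) < 1 / 2) a).const_mul _
  calc ‖∫ u in Iic a, cexp (phase L₂ t₀ x u)‖
      ≤ ∫ u in Iic a, ‖cexp (phase L₂ t₀ x u)‖ := norm_integral_le_integral_norm _
    _ ≤ ∫ u in Iic a, Real.exp (-K) * Real.exp (1 / 2 * u) :=
        setIntegral_mono_on (integrable_cexp_phase hL t₀ x).norm.integrableOn hint
          measurableSet_Iic hpt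
    _ = Real.exp (-K) * (Real.exp (1 / 2 * a) / (1 / 2)) := by
        rw [MeasureTheory.integral_const_mul, integral_exp_mul_Iic (by norm_num)]
    _ ≤ 2 * Real.exp (-K) := by
        have ha0 : a ≤ 0 := by rw [ha]; linarith
        have : Real.exp (1 / 2 * a) ≤ 1 := by rw [Real.exp_le_one_iff]; linarith
        have hK0 : 0 < Real.exp (-K) := Real.exp_pos _
        nlinarith

/-- **(5.12), `j = 2`**: for `a = −c·log x` with `c·log x ≥ 0`, `L₂ ≥ 1`, `0 < X ≤ xe^{a}`, `2t₀ < X`: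
`‖i∫_{−1/L₂}^{0} e^{phase(a + iy)} dy‖ ≤ e^{1 − (cL₂ log x)²}/L₂` (on `L′₂`, `Re phase ≤ −(cL₂ log x)² + 1`).
[cite: Zhang2022LandauSiegel, §5 Lemma 5.3 (proof), (5.12)] -/
theorem norm_integral_L2'_le {L₂ : ℝ} (hL : 1 ≤ L₂) (t₀ x : ℝ) {c X : ℝ} (hc : 0 ≤ c * Real.log x)
    (hX : 0 < X) (hXle : X ≤ x * Real.exp (-(c * Real.log x))) (ht : 2 * t₀ < X) :
    ‖I * ∫ y in (-(1 / L₂))..0, cexp (phase L₂ t₀ x ((-(c * Real.log x) : ℝ) + y * I))‖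
      ≤ Real.exp (1 - (c * L₂ * Real.log x) ^ 2) / L₂ := by
  have hL0 : 0 < L₂ := by linarith
  have hpt : ∀ y ∈ Set.uIoc (-(1 / L₂)) (0 : ℝ),
      ‖cexp (phase L₂ t₀ x ((-(c * Real.log x) : ℝ) + y * I))‖
        ≤ Real.exp (1 - (c * L₂ * Real.log x) ^ 2) := by
    intro y hy
    rw [Set.uIoc_of_le (by rw [neg_nonpos]; positivity)] at hy
    rw [Complex.norm_exp]
    apply Real.exp_le_exp.mpr
    have := re_phase_le_L2' hL t₀ x hc hy.1.le hy.2 hX hXle ht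
    linarith
  rw [norm_mul, Complex.norm_I, one_mul]
  calc ‖∫ y in (-(1 / L₂))..0, cexp (phase L₂ t₀ x ((-(c * Real.log x) : ℝ) + y * I))‖
      ≤ Real.exp (1 - (c * L₂ * Real.log x) ^ 2) * |0 - -(1 / L₂)| :=
        intervalIntegral.norm_integral_le_of_norm_le_const hpt
    _ = Real.exp (1 - (c * L₂ * Real.log x) ^ 2) / L₂ := by
        rw [sub_neg_eq_add, zero_add, abs_of_pos (one_div_pos.mpr hL0)]; ring

/-- `∫_ℝ e^{u/2 − L₂²u²} du = e^{1/(16L₂²)}·√π/L₂` (completing the square). [folklore] -/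
private lemma integral_exp_half_sub_sq' {L₂ : ℝ} (hL : 0 < L₂) :
    ∫ u : ℝ, Real.exp (u / 2 - L₂ ^ 2 * u ^ 2)
      = Real.exp (1 / (16 * L₂ ^ 2)) * (Real.sqrt π / L₂) := by
  have hL2 : 0 < L₂ ^ 2 := by positivity
  have e : (fun u : ℝ => Real.exp (u / 2 - L₂ ^ 2 * u ^ 2))
      = fun u : ℝ => Real.exp (1 / (16 * L₂ ^ 2))
          * (fun y : ℝ => Real.exp (-(L₂ ^ 2) * y ^ 2)) (u - 1 / (4 * L₂ ^ 2)) := by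
    funext u
    simp only
    rw [← Real.exp_add]
    congr 1
    field_simp
    ring
  rw [e, MeasureTheory.integral_const_mul,
    integral_sub_right_eq_self (fun y : ℝ => Real.exp (-(L₂ ^ 2) * y ^ 2)) (1 / (4 * L₂ ^ 2)),
    integral_gaussian, Real.sqrt_div' _ hL2.le, Real.sqrt_sq hL.le]

/-- **(5.12), `j = 3`**: for `L₂ ≥ 1`, `x ≥ 0`, `0 < X ≤ xe^{a}`, `2t₀ < X`:
`‖∫_{u > a} e^{phase(u − i/L₂)} du‖ ≤ e^{1 + 1/(16L₂²)}(√π/L₂)·e^{−X/L₂}`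
(on `L′₃`, `Re phase < 1 + u/2 − (L₂u)² − X/L₂`, and `∫_ℝ e^{u/2 − L₂²u²} = e^{1/(16L₂²)}√π/L₂`).
[cite: Zhang2022LandauSiegel, §5 Lemma 5.3 (proof), (5.12)] -/
theorem norm_integral_L3'_le {L₂ : ℝ} (hL : 1 ≤ L₂) (t₀ : ℝ) {x a X : ℝ} (hx : 0 ≤ x)
    (hX : 0 < X) (hXle : X ≤ x * Real.exp a) (ht : 2 * t₀ < X) :
    ‖∫ u in Ioi a, cexp (phase L₂ t₀ x (u + (-(1 / L₂) : ℝ) * I))‖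
      ≤ Real.exp (1 + 1 / (16 * L₂ ^ 2)) * (Real.sqrt π / L₂) * Real.exp (-(X / L₂)) := by
  have hL0 : 0 < L₂ := by linarith
  have hL1 : 1 / L₂ ≤ 1 := (div_le_one hL0).mpr hL
  set C : ℝ := Real.exp (1 - X / L₂) with hC
  have hpt : ∀ u ∈ Ioi a, ‖cexp (phase L₂ t₀ x (u + (-(1 / L₂) : ℝ) * I))‖
      ≤ C * Real.exp (u / 2 - L₂ ^ 2 * u ^ 2) := by
    intro u hu
    have hu' : a < u := hu
    have hXu : X ≤ x * Real.exp u :=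
      hXle.trans (mul_le_mul_of_nonneg_left (Real.exp_le_exp.mpr hu'.le) hx)
    rw [Complex.norm_exp, hC, ← Real.exp_add]
    apply Real.exp_le_exp.mpr
    have := re_phase_lt_L3' hL t₀ x u hX hXu ht
    have e1 : (L₂ * u) ^ 2 = L₂ ^ 2 * u ^ 2 := by ring
    linarith
  have hgi : Integrable fun u : ℝ => Real.exp (u / 2 - L₂ ^ 2 * u ^ 2) := by
    have := integrable_exp_lin_sub_sq hL0.ne' (1 / 2)
    refine this.congr (Eventually.of_forall fun u => ?_)
    simp only; congr 1; ring
  have hint' := integrable_cexp_phase_shift hL0.ne' t₀ hx (v := -(1 / L₂)) (by linarith)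
    (by rw [neg_nonpos]; positivity)
  calc ‖∫ u in Ioi a, cexp (phase L₂ t₀ x (u + (-(1 / L₂) : ℝ) * I))‖
      ≤ ∫ u in Ioi a, ‖cexp (phase L₂ t₀ x (u + (-(1 / L₂) : ℝ) * I))‖ :=
        norm_integral_le_integral_norm _
    _ ≤ ∫ u in Ioi a, C * Real.exp (u / 2 - L₂ ^ 2 * u ^ 2) :=
        setIntegral_mono_on hint'.norm.integrableOn (hgi.const_mul C).integrableOn
          measurableSet_Ioi hpt
    _ ≤ ∫ u : ℝ, C * Real.exp (u / 2 - L₂ ^ 2 * u ^ 2) :=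
        setIntegral_le_integral (hgi.const_mul C)
          (Eventually.of_forall fun u => by positivity)
    _ = Real.exp (1 + 1 / (16 * L₂ ^ 2)) * (Real.sqrt π / L₂) * Real.exp (-(X / L₂)) := by
        rw [MeasureTheory.integral_const_mul, integral_exp_half_sub_sq' hL0, hC,
          show (1 : ℝ) - X / L₂ = 1 + -(X / L₂) by ring, Real.exp_add, Real.exp_add]
        ring

/-! ## (5.9) in explicit form -/

/-- **(5.9), explicit**: for `L₂ ≥ 1`, `x ≥ 0`, `c` with `c·log x ≥ 0`, and `X` with
`0 < X ≤ x·e^{−c log x}` (`= x^{1−c}`), `2t₀ < X`: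
`‖Δ(x)‖ ≤ 2e^{−(cL₂ log x)²} + e^{1−(cL₂ log x)²}/L₂ + e^{1+1/(16L₂²)}(√π/L₂)·e^{−X/L₂}`
(the source, with `c = 10^{−2}`, `X = x^{0.99}`: "`Δ(x) ≪ exp{−(10^{−2}𝓛₂ log x)²} + exp{−x^{0.99}/𝓛₂}`").
[cite: Zhang2022LandauSiegel, §5 Lemma 5.3, (5.9)] -/
theorem norm_Delta510_le_caseTwo {L₂ : ℝ} (hL : 1 ≤ L₂) (t₀ : ℝ) {x c X : ℝ} (hx : 0 ≤ x)
    (hc : 0 ≤ c * Real.log x) (hX : 0 < X) (hXle : X ≤ x * Real.exp (-(c * Real.log x)))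
    (ht : 2 * t₀ < X) :
    ‖Delta510 L₂ t₀ x‖
      ≤ 2 * Real.exp (-(c * L₂ * Real.log x) ^ 2)
        + Real.exp (1 - (c * L₂ * Real.log x) ^ 2) / L₂
        + Real.exp (1 + 1 / (16 * L₂ ^ 2)) * (Real.sqrt π / L₂) * Real.exp (-(X / L₂)) := by
  have hL0 : 0 < L₂ := by linarith
  rw [Delta510_eq_contour hL t₀ hx (-(c * Real.log x))]
  have h1 := norm_integral_L1'_le hL0.ne' t₀ x hc
  have h2 := norm_integral_L2'_le hL t₀ x hc hX hXle ht
  have h3 := norm_integral_L3'_le hL t₀ hx hX hXle ht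
  calc ‖(∫ u in Iic (-(c * Real.log x)), cexp (phase L₂ t₀ x u))
        + (∫ u in Ioi (-(c * Real.log x)), cexp (phase L₂ t₀ x (u + (-(1 / L₂) : ℝ) * I)))
        - I * ∫ y in (-(1 / L₂))..0, cexp (phase L₂ t₀ x ((-(c * Real.log x) : ℝ) + y * I))‖
      ≤ ‖∫ u in Iic (-(c * Real.log x)), cexp (phase L₂ t₀ x u)‖
        + ‖∫ u in Ioi (-(c * Real.log x)), cexp (phase L₂ t₀ x (u + (-(1 / L₂) : ℝ) * I))‖
        + ‖I * ∫ y in (-(1 / L₂))..0, cexp (phase L₂ t₀ x ((-(c * Real.log x) : ℝ) + y * I))‖ :=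
        (norm_sub_le _ _).trans (add_le_add (norm_add_le _ _) le_rfl)
    _ ≤ 2 * Real.exp (-(c * L₂ * Real.log x) ^ 2)
        + Real.exp (1 + 1 / (16 * L₂ ^ 2)) * (Real.sqrt π / L₂) * Real.exp (-(X / L₂))
        + Real.exp (1 - (c * L₂ * Real.log x) ^ 2) / L₂ := add_le_add (add_le_add h1 h3) h2
    _ = _ := by ring

end Lemma53

end Literature.NumberTheory.LFunctions.Zhang2022
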